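import Literature.AnabelianGeometry.SemiGraphs.TemperedSpecialFibreReductions
import HarnessLib

/-!
# Corollary 3.11, step (S3) in the γ-DESCENDED shape print actually proves (additive twin of
# `TemperedSpecialFibreReductions.lean`)

Mochizuki, *Semi-graphs of anabelioids*, Publ. RIMS **42** (2006), §3, Corollary 3.11, proof,
manuscript pp. 46–48 [cite: MochizukiSemiAnbd2006, Cor 3.11 pp.46-48].  ADDITIVE file (cell abc-iut,
layer L3; ruling α9 of abc-iut-L3-lead, 2026-08-26, on RQ7 finding F-w4d058g2-1; the frozen
`TemperedSpecialFibreReductions.lean` is NOT edited).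

`TemperedSpecialFibreReductions.lean` reduces the predicate `Cor311` to three named residual steps.  Its
step (S3) `SpecialFibreIsoOfChartIso` quantifies over EVERY isomorphism
`φ : π₁^temp(G^c[α]) ⥲ π₁^temp(G^c[β])` of the tempered fundamental groups of the special-fibre semi-graphs of
anabelioids WITH COMPACT STRUCTURE and asserts an isomorphism `G^c[α] ⥲ G^c[β]` (cusps included) compatible
with `φ`.  Print (p. 46 l. −8 – p. 48 l. 8) proves this only for the isomorphism INDUCED BY
`γ : Δ[α] ⥲ Δ[β]`: Corollary 3.9 gives `G[α]_Σ ⥲ G[β]_Σ` for the graphs WITHOUT compact structure, and the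
extension to `G^c` "follows formally from (i), (ii), (iii), (iv)", where (i) transports `γ` to "open
subgroups of finite index `Δ′[α] ⊆ Δ[α]`, `Δ′[β] ⊆ Δ[β]` that correspond via `γ`" (finite étale coverings of
the CURVE) and (iv) detects cusps through coverings "ramified over the irreducible component …" with
collapsing components — curve-level data that an arbitrary `φ` at the special-fibre level does not carry.
(At the intended model the `φ`-form fails: for `P¹ ∖ {0,1,∞}` the automorphism `a ↦ a`, `b ↦ ba` of
`Π_v = π₁^temp(G^c)` moves the cuspidal class of `ab` off every cuspidal class — cell audit F-w4d058g2-1,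
kernel witness `WitnessCuspNonPreservingAut.lean` on the discrete skeleton.)

This file records the step in the shape print proves — binding `γ` and the descent along the admissible
quotients — and re-proves the glue:

* `SpecialFibreIsoOfDescendedIso` — (S3′) p. 48 l. 1–6: "the natural, functorial isomorphism of graphs of
  anabelioids `G[α]_Σ ⥲ G[β]_Σ` induced by `γ` extends uniquely to a natural, functorial isomorphism of
  semi-graphs of anabelioids `G^c[α]_Σ ⥲ G^c[β]_Σ` [which may also be regarded as being induced by `γ`],
  hence, in particular, an isomorphism of semi-graphs `G^c[α] ⥲ G^c[β]`";
* `specialFibreIsoOfDescendedIso_of_chartIso` — the frozen (S3) implies (S3′) (so nothing proved from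
  (S3′) is weaker than what the frozen reduction gives);
* `corollary_3_11_of_steps'` — `Cor311` from (S1) `AdmissibleQuotientCompatible`, (S2)
  `ResidueCharOfTemperedIso` and (S3′), verbatim the proof of `corollary_3_11_of_steps`.

Named residual fact (S3′) is FACT-policy like (S1)–(S3) (it rests on the tempered fundamental groups of
actual curves); typed ≠ discharged; nothing here takes a side on [IUTchIII] Cor. 3.12.
-/

open CategoryTheory Topology

noncomputable section

namespace Literature.AnabelianGeometry.SemiGraphs

open ProfiniteSemiGraph

universe u

variable {Kα : Type u} [Field Kα] {Kβ : Type u} [Field Kβ]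

/-- (S3′) **The isomorphism of special-fibre semi-graphs of anabelioids induced by `γ`** ([SemiAnbd]
Cor. 3.11, proof, p. 48 l. 1–6: "Thus, in summary, it follows formally from (i), (ii), (iii), (iv) that the
natural, functorial isomorphism of graphs of anabelioids `G[α]_Σ ⥲ G[β]_Σ` induced by `γ` extends uniquely
to a natural, functorial isomorphism of semi-graphs of anabelioids `G^c[α]_Σ ⥲ G^c[β]_Σ` [which may also be
regarded as being induced by `γ`], hence, in particular, an isomorphism of semi-graphs `G^c[α] ⥲ G^c[β]`"),
named residual fact over the origin hypotheses, in the γ-DESCENDED shape: for every isomorphism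
`γ : Δ[α] ⥲ Δ[β]` and every `φ : π₁^temp(G^c[α]) ⥲ π₁^temp(G^c[β])` DESCENDED from `γ` along the admissible
quotients (`φ ∘ admissible_α = admissible_β ∘ γ`), there is an isomorphism `F : G^c[α] ⥲ G^c[β]` of
semi-graphs of anabelioids with compact structure that is chart-compatible with `φ`, unique on underlying
semi-graphs.  (Additive twin of the frozen (S3) `SpecialFibreIsoOfChartIso`, which omits the binder `γ`;
ruling α9 on finding F-w4d058g2-1.) [cite: MochizukiSemiAnbd2006, Cor 3.11 p.48] -/
def SpecialFibreIsoOfDescendedIso (Ωα : SpecialFibreOrigin Kα) (Ωβ : SpecialFibreOrigin Kβ) : Prop :=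
  ∀ (Dα : TemperedArithmeticGroup Kα) (Dβ : TemperedArithmeticGroup Kβ)
    (Sα : SpecialFibreData Dα) (Sβ : SpecialFibreData Dβ),
    Ωα.IsSpecialFibreOf Dα Sα → Ωβ.IsSpecialFibreOf Dβ Sβ →
    ∀ (γ : Dα.delta ≃ₜ* Dβ.delta) (φ : Sα.chart.G ≃ₜ* Sβ.chart.G),
      (∀ x : Dα.delta, φ (Sα.admissible x) = Sβ.admissible (γ x)) →
      ∃ F : Hom Sα.Gc Sβ.Gc, F.IsIso ∧ Sα.ChartCompatible Sβ φ F ∧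
        ∀ F' : Hom Sα.Gc Sβ.Gc, F'.IsIso → Sα.ChartCompatible Sβ φ F' →
          F'.base.vertexMap = F.base.vertexMap ∧ F'.base.edgeMap = F.base.edgeMap

/-- The frozen (S3) `SpecialFibreIsoOfChartIso` (every `φ`) implies (S3′) (the `φ` descended from some
`γ`): forgetting the descent hypothesis. [cite: MochizukiSemiAnbd2006, Cor 3.11 p.48] -/
theorem specialFibreIsoOfDescendedIso_of_chartIso (Ωα : SpecialFibreOrigin Kα)
    (Ωβ : SpecialFibreOrigin Kβ) (h : SpecialFibreIsoOfChartIso Ωα Ωβ) :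
    SpecialFibreIsoOfDescendedIso Ωα Ωβ :=
  fun Dα Dβ Sα Sβ hα hβ _ φ _ => h Dα Dβ Sα Sβ hα hβ φ

/-- **[SemiAnbd] Cor. 3.11 from the steps of its printed proof, with (S3) in the γ-descended shape**
(pp. 45–49): `γ` descends along the admissible quotients (S1) to an isomorphism `φ` of the tempered
fundamental groups of the special fibres; (S3′) applied to `γ` and this `φ` gives an isomorphism
`F : G^c[α] ⥲ G^c[β]` compatible with `φ` — so `F` is `Cor311Compatible` with `γ`; any other compatible
isomorphism `F'` carries a descended isomorphism, which equals `φ` (`SpecialFibreData.descended_unique`), so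
`F'` and `F` agree on underlying semi-graphs by the uniqueness clause of (S3′); and `p_α = p_β` by (S2).
Verbatim the proof of `corollary_3_11_of_steps` with `hS3'` in place of `hS3`.
[cite: MochizukiSemiAnbd2006, Cor 3.11 pp.45-49] -/
theorem corollary_3_11_of_steps' (pα pβ : ℕ) [Fact pα.Prime] [Fact pβ.Prime] [Algebra ℚ_[pα] Kα]
    [FiniteDimensional ℚ_[pα] Kα] [Algebra ℚ_[pβ] Kβ] [FiniteDimensional ℚ_[pβ] Kβ]
    (Ωα : SpecialFibreOrigin Kα) (Ωβ : SpecialFibreOrigin Kβ)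
    (hS1 : AdmissibleQuotientCompatible Ωα Ωβ) (hS2 : ResidueCharOfTemperedIso pα pβ Ωα Ωβ)
    (hS3' : SpecialFibreIsoOfDescendedIso Ωα Ωβ) : Cor311 pα pβ Ωα Ωβ := by
  intro Dα Dβ Sα Sβ hα hβ γ
  obtain ⟨φ, hφ⟩ := hS1 Dα Dβ Sα Sβ hα hβ γ
  obtain ⟨F, hF, hc, huniq⟩ := hS3' Dα Dβ Sα Sβ hα hβ γ φ hφ
  refine ⟨⟨F, hF, ⟨φ, hφ, hc⟩, fun F' hF' hcomp' => ?_⟩, hS2 Dα Dβ Sα Sβ hα hβ ⟨γ⟩⟩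
  obtain ⟨φ', hφ', hc'⟩ := hcomp'
  obtain rfl : φ' = φ := Sα.descended_unique Sβ γ hφ hφ'
  exact huniq F' hF' hc'

end Literature.AnabelianGeometry.SemiGraphs

end
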